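import Mathlib
import HarnessLib
import Summits.CriticalPhenomena.PercolationContinuityZ3.Theses.PercDustRigidity

/-!
# Birth skeleton of piece X₂ `SieveCoarsening` (BC2 redirect of `DustRigidity`, item
`stmt-CriticalPhenomena-9591`, route `PercDustRigidity`; crux-strategist 2026-08-17)

X₂: for a probability measure on bond configurations of `ℤ³` with (H1)–(H9) and a.s. at most one
infinite cluster, and `k ≥ 1`: `Death_μ(D_k) ⟹ Death_μ(D_{k+1})` — if the level-`k` plug sieve
`D_k = {s(y, y+e₃) : 2^k ∣ y_i}` kills every infinite cluster, so does the eight times sparser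
`D_{k+1} ⊆ D_k`.

`D_k` is the disjoint union of the eight cosets `D_{k+1} + v`, `v ∈ {0, 2^k}³`, and the shift by
`v` is a symmetry of `μ` (H2), so the eight cosets are INTERCHANGEABLE: `Death_μ(D_{k+1} + v) ⟺
Death_μ(D_{k+1})` (`stub_cosetSymmetry`, provable now: the event "all clusters of `ω \ (T+v)` are
finite" is the shift-preimage of the same event for `T`). The heart (`stub_core`, open) is then:
a giant (unique, stationary, associated, finite-energy, weaving by (H9)) that is cut into finite
pieces by the UNION of eight interchangeable cosets is already cut by ONE of them — fragility does
not need all eight colours. Within Bernoulli measures this is exactly where (H9) bites: `P_p` with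
`p_c(ℤ³∖D_{k+1}) < p < p_c(ℤ³∖D_k)` has `Death(D_k) ∧ ¬Death(D_{k+1})` but percolates in slabs
(Grimmett–Marstrand), violating (H9).
-/

namespace Summit.CriticalPhenomena.PercolationContinuityZ3.Cruxes.DustRigidity.BirthX2

open scoped BigOperators Topology Classical MeasureTheory ProbabilityTheory
open Filter Set Function TopologicalSpace MeasureTheory


/-- Coset symmetry: the eight cosets of `D_{k+1}` in `D_k` are interchangeable under `μ` (H2). -/
theorem stub_cosetSymmetry :
    ∀ μ : MeasureTheory.Measure (Literature.Probability.Percolation.BondConfig (Literature.Probability.LatticeModels.Site 3)), MeasureTheory.IsProbabilityMeasure μ → (∀ (v : Literature.Probability.LatticeModels.Site 3) (S : Set (Literature.Probability.Percolation.BondConfig (Literature.Probability.LatticeModels.Site 3))), MeasurableSet S → μ (Literature.Probability.Percolation.BondConfig.relabel (Literature.Probability.Percolation.sym2Equiv (Literature.Probability.LatticeModels.Site.shift v)) ⁻¹' S) = μ S) → ∀ k : ℕ, 1 ≤ k → ∀ v : Literature.Probability.LatticeModels.Site 3, (∀ i, v i = 0 ∨ v i = 2 ^ k) → ((∀ᵐ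 ω ∂μ, ∀ x : Literature.Probability.LatticeModels.Site 3, (Literature.Probability.Percolation.openCluster (ω \ {e | ∃ y : Literature.Probability.LatticeModels.Site 3, (∀ i, (2 ^ (k + 1) : ℤ) ∣ y i) ∧ e = s(y + v, y + v + Pi.single (2 : Fin 3) 1)}) x).Finite) ↔ (∀ᵐ ω ∂μ, ∀ x : Literature.Probability.LatticeModels.Site 3, (Literature.Probability.Percolation.openCluster (ω \ {e | ∃ y : Literature.Probability.LatticeModels.Site 3, (∀ i, (2 ^ (k + 1) : ℤ) ∣ y i) ∧ e = s(y, y + Pi.single (2 : Fin 3) 1)}) x).Finite)) := by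
  sorry

/-- The core: killed by the union of eight interchangeable cosets ⟹ killed by one coset. -/
theorem stub_core :
    ∀ μ : MeasureTheory.Measure (Literature.Probability.Percolation.BondConfig (Literature.Probability.LatticeModels.Site 3)), MeasureTheory.IsProbabilityMeasure μ → (∀ᵐ ω ∂μ, ω ⊆ (Literature.Probability.LatticeModels.zdGraph 3).edgeSet) → (∀ (v : Literature.Probability.LatticeModels.Site 3) (S : Set (Literature.Probability.Percolation.BondConfig (Literature.Probability.LatticeModels.Site 3))), MeasurableSet S → μ (Literature.Probability.Percolation.BondConfig.relabel (Literature.Probability.Percolation.sym2Equiv (Literature.Probability.LatticeModels.Site.shift v)) ⁻¹' S) = μ S) → (∀ S : Set (Literature.Probability.Percolation.BondConfig (Literature.Probability.LatticeModels.Site 3)), MeasurableSet S → (∀ v : Literature.Probability.LatticeModels.Site 3, Literature.Probability.Percolation.BondConfig.relabel (Literature.Probability.Percolation.sym2Equiv (Literature.Probability.LatticeModels.Site.shift v)) ⁻¹' S = S) → μ S = 0 ∨ μ S = 1) → (∀ N : ℕ, ∃ c : ℝ, 0 < c ∧ ∀ S : Set (Literature.Probability.Percolation.BondConfig (Literature.Probability.LatticeModels.Site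 3)), MeasurableSet S → c * μ.real ((fun ω : Literature.Probability.Percolation.BondConfig (Literature.Probability.LatticeModels.Site 3) => ω ∪ ↑(Literature.Probability.LatticeModels.edgesIn (Literature.Probability.LatticeModels.zdGraph 3) (Literature.Probability.LatticeModels.box 3 N))) ⁻¹' S) ≤ μ.real S) → (∀ N : ℕ, ∃ c : ℝ, 0 < c ∧ ∀ S : Set (Literature.Probability.Percolation.BondConfig (Literature.Probability.LatticeModels.Site 3)), MeasurableSet S → c * μ.real ((fun ω : Literature.Probability.Percolation.BondConfig (Literature.Probability.LatticeModels.Site 3) => ω \ ↑(Literature.Probability.LatticeModels.edgesIn (Literature.Probability.LatticeModels.zdGraph 3) (Literature.Probability.LatticeModels.box 3 N))) ⁻¹' S) ≤ μ.real S) → (∀ v : Literature.Probability.LatticeModels.Site 3, v ≠ 0 → Ergodic (Literature.Probability.Percolation.BondConfig.relabel (Literature.Probability.Percolation.sym2Equiv (Literature.Probability.LatticeModels.Site.shift v))) μ) → (∀ (γ : Literature.Probability.LatticeModels.zdGraph 3 ≃g Literature.Probability.LatticeModels.zdGraph 3) (A : Set (Literature.Probability.Percolation.BondConfig (Literature.Probability.LatticeModels.Site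 3))), MeasurableSet A → μ (Literature.Probability.Percolation.BondConfig.relabel (Literature.Probability.Percolation.sym2Equiv γ.toEquiv) ⁻¹' A) = μ A) → (∀ A B : Set (Literature.Probability.Percolation.BondConfig (Literature.Probability.LatticeModels.Site 3)), IsUpperSet A → IsUpperSet B → MeasurableSet A → MeasurableSet B → μ A * μ B ≤ μ (A ∩ B)) → (∀ᵐ ω ∂μ, ∀ (i : Fin 3) (a : ℤ) (v : Literature.Probability.LatticeModels.Site 3), {y : Literature.Probability.LatticeModels.Site 3 | ω ∈ Literature.Probability.Percolation.openConnIn {x : Literature.Probability.LatticeModels.Site 3 | a ≤ x i} v y}.Finite ∧ {y : Literature.Probability.LatticeModels.Site 3 | ω ∈ Literature.Probability.Percolation.openConnIn {x : Literature.Probability.LatticeModels.Site 3 | x i ≤ a} v y}.Finite) → (∀ᵐ ω ∂μ, Literature.Probability.Percolation.numInfiniteClusters ω ≤ 1) → ∀ k : ℕ, 1 ≤ k → (∀ᵐ ω ∂μ, ∀ x : Literature.Probability.LatticeModels.Site 3, (Literature.Probability.Percolation.openCluster (ω \ {e | ∃ y : Literature.Probability.LatticeModels.Site 3, (∀ i,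 (2 ^ k : ℤ) ∣ y i) ∧ e = s(y, y + Pi.single (2 : Fin 3) 1)}) x).Finite) → (∀ v : Literature.Probability.LatticeModels.Site 3, (∀ i, v i = 0 ∨ v i = 2 ^ k) → ((∀ᵐ ω ∂μ, ∀ x : Literature.Probability.LatticeModels.Site 3, (Literature.Probability.Percolation.openCluster (ω \ {e | ∃ y : Literature.Probability.LatticeModels.Site 3, (∀ i, (2 ^ (k + 1) : ℤ) ∣ y i) ∧ e = s(y + v, y + v + Pi.single (2 : Fin 3) 1)}) x).Finite) ↔ (∀ᵐ ω ∂μ, ∀ x : Literature.Probability.LatticeModels.Site 3, (Literature.Probability.Percolation.openCluster (ω \ {e | ∃ y : Literature.Probability.LatticeModels.Site 3, (∀ i, (2 ^ (k + 1) : ℤ) ∣ y i) ∧ e = s(y, y + Pi.single (2 : Fin 3) 1)}) x).Finite))) → ∀ᵐ ω ∂μ, ∀ x : Literature.Probability.LatticeModels.Site 3, (Literature.Probability.Percolation.openCluster (ω \ {e | ∃ y : Literature.Probability.LatticeModels.Site 3, (∀ i, (2 ^ (k + 1) : ℤ) ∣ y i) ∧ e = s(y, y + Pi.single (2 : Fin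 3) 1)}) x).Finite := by
  sorry

/-- The line closes X₂ from its registered stubs (skeleton theorem: stubs used BY NAME). -/
theorem SieveCoarsening_holds_of_stubs :
    Summit.CriticalPhenomena.PercolationContinuityZ3.Theses.PercDustRigidity.SieveCoarsening := by
  intro μ hμ h1 h2 h3 h4 h5 h6 h7 h8 h9 hU k hk hDk
  exact stub_core μ hμ h1 h2 h3 h4 h5 h6 h7 h8 h9 hU k hk hDk (fun v hv => stub_cosetSymmetry μ hμ h2 k hk v hv)

/-- Composition: the two stubs prove X₂. -/
theorem SieveCoarsening_of
    (hsym : ∀ μ : MeasureTheory.Measure (Literature.Probability.Percolation.BondConfig (Literature.Probability.LatticeModels.Site 3)), MeasureTheory.IsProbabilityMeasure μ → (∀ (v : Literature.Probability.LatticeModels.Site 3) (S : Set (Literature.Probability.Percolation.BondConfig (Literature.Probability.LatticeModels.Site 3))), MeasurableSet S → μ (Literature.Probability.Percolation.BondConfig.relabel (Literature.Probability.Percolation.sym2Equiv (Literature.Probability.LatticeModels.Site.shift v)) ⁻¹' S) = μ S) → ∀ k : ℕ, 1 ≤ k → ∀ v : Literature.Probability.LatticeModels.Site 3, (∀ i,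 v i = 0 ∨ v i = 2 ^ k) → ((∀ᵐ ω ∂μ, ∀ x : Literature.Probability.LatticeModels.Site 3, (Literature.Probability.Percolation.openCluster (ω \ {e | ∃ y : Literature.Probability.LatticeModels.Site 3, (∀ i, (2 ^ (k + 1) : ℤ) ∣ y i) ∧ e = s(y + v, y + v + Pi.single (2 : Fin 3) 1)}) x).Finite) ↔ (∀ᵐ ω ∂μ, ∀ x : Literature.Probability.LatticeModels.Site 3, (Literature.Probability.Percolation.openCluster (ω \ {e | ∃ y : Literature.Probability.LatticeModels.Site 3, (∀ i, (2 ^ (k + 1) : ℤ) ∣ y i) ∧ e = s(y, y + Pi.single (2 : Fin 3) 1)}) x).Finite)))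
    (hcore : ∀ μ : MeasureTheory.Measure (Literature.Probability.Percolation.BondConfig (Literature.Probability.LatticeModels.Site 3)), MeasureTheory.IsProbabilityMeasure μ → (∀ᵐ ω ∂μ, ω ⊆ (Literature.Probability.LatticeModels.zdGraph 3).edgeSet) → (∀ (v : Literature.Probability.LatticeModels.Site 3) (S : Set (Literature.Probability.Percolation.BondConfig (Literature.Probability.LatticeModels.Site 3))), MeasurableSet S → μ (Literature.Probability.Percolation.BondConfig.relabel (Literature.Probability.Percolation.sym2Equiv (Literature.Probability.LatticeModels.Site.shift v)) ⁻¹' S) = μ S) → (∀ S : Set (Literature.Probability.Percolation.BondConfig (Literature.Probability.LatticeModels.Site 3)), MeasurableSet S → (∀ v : Literature.Probability.LatticeModels.Site 3, Literature.Probability.Percolation.BondConfig.relabel (Literature.Probability.Percolation.sym2Equiv (Literature.Probability.LatticeModels.Site.shift v)) ⁻¹' S = S) → μ S = 0 ∨ μ S = 1) → (∀ N : ℕ, ∃ c : ℝ, 0 < c ∧ ∀ S : Set (Literature.Probability.Percolation.BondConfig (Literature.Probability.LatticeModels.Site 3)), MeasurableSet S → c * μ.real ((fun ω : Literature.Probability.Percolation.BondConfig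 (Literature.Probability.LatticeModels.Site 3) => ω ∪ ↑(Literature.Probability.LatticeModels.edgesIn (Literature.Probability.LatticeModels.zdGraph 3) (Literature.Probability.LatticeModels.box 3 N))) ⁻¹' S) ≤ μ.real S) → (∀ N : ℕ, ∃ c : ℝ, 0 < c ∧ ∀ S : Set (Literature.Probability.Percolation.BondConfig (Literature.Probability.LatticeModels.Site 3)), MeasurableSet S → c * μ.real ((fun ω : Literature.Probability.Percolation.BondConfig (Literature.Probability.LatticeModels.Site 3) => ω \ ↑(Literature.Probability.LatticeModels.edgesIn (Literature.Probability.LatticeModels.zdGraph 3) (Literature.Probability.LatticeModels.box 3 N))) ⁻¹' S) ≤ μ.real S) → (∀ v : Literature.Probability.LatticeModels.Site 3, v ≠ 0 → Ergodic (Literature.Probability.Percolation.BondConfig.relabel (Literature.Probability.Percolation.sym2Equiv (Literature.Probability.LatticeModels.Site.shift v))) μ) → (∀ (γ : Literature.Probability.LatticeModels.zdGraph 3 ≃g Literature.Probability.LatticeModels.zdGraph 3) (A : Set (Literature.Probability.Percolation.BondConfig (Literature.Probability.LatticeModels.Site 3))), MeasurableSet A → μ (Literature.Probability.Percolation.BondConfig.relabel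 (Literature.Probability.Percolation.sym2Equiv γ.toEquiv) ⁻¹' A) = μ A) → (∀ A B : Set (Literature.Probability.Percolation.BondConfig (Literature.Probability.LatticeModels.Site 3)), IsUpperSet A → IsUpperSet B → MeasurableSet A → MeasurableSet B → μ A * μ B ≤ μ (A ∩ B)) → (∀ᵐ ω ∂μ, ∀ (i : Fin 3) (a : ℤ) (v : Literature.Probability.LatticeModels.Site 3), {y : Literature.Probability.LatticeModels.Site 3 | ω ∈ Literature.Probability.Percolation.openConnIn {x : Literature.Probability.LatticeModels.Site 3 | a ≤ x i} v y}.Finite ∧ {y : Literature.Probability.LatticeModels.Site 3 | ω ∈ Literature.Probability.Percolation.openConnIn {x : Literature.Probability.LatticeModels.Site 3 | x i ≤ a} v y}.Finite) → (∀ᵐ ω ∂μ, Literature.Probability.Percolation.numInfiniteClusters ω ≤ 1) → ∀ k : ℕ, 1 ≤ k → (∀ᵐ ω ∂μ, ∀ x : Literature.Probability.LatticeModels.Site 3, (Literature.Probability.Percolation.openCluster (ω \ {e | ∃ y : Literature.Probability.LatticeModels.Site 3, (∀ i, (2 ^ k : ℤ) ∣ y i) ∧ e = s(y, y + Pi.single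 (2 : Fin 3) 1)}) x).Finite) → (∀ v : Literature.Probability.LatticeModels.Site 3, (∀ i, v i = 0 ∨ v i = 2 ^ k) → ((∀ᵐ ω ∂μ, ∀ x : Literature.Probability.LatticeModels.Site 3, (Literature.Probability.Percolation.openCluster (ω \ {e | ∃ y : Literature.Probability.LatticeModels.Site 3, (∀ i, (2 ^ (k + 1) : ℤ) ∣ y i) ∧ e = s(y + v, y + v + Pi.single (2 : Fin 3) 1)}) x).Finite) ↔ (∀ᵐ ω ∂μ, ∀ x : Literature.Probability.LatticeModels.Site 3, (Literature.Probability.Percolation.openCluster (ω \ {e | ∃ y : Literature.Probability.LatticeModels.Site 3, (∀ i, (2 ^ (k + 1) : ℤ) ∣ y i) ∧ e = s(y, y + Pi.single (2 : Fin 3) 1)}) x).Finite))) → ∀ᵐ ω ∂μ, ∀ x : Literature.Probability.LatticeModels.Site 3, (Literature.Probability.Percolation.openCluster (ω \ {e | ∃ y : Literature.Probability.LatticeModels.Site 3, (∀ i, (2 ^ (k + 1) : ℤ) ∣ y i) ∧ e = s(y, y + Pi.single (2 : Fin 3) 1)}) x).Finite) :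
    Summit.CriticalPhenomena.PercolationContinuityZ3.Theses.PercDustRigidity.SieveCoarsening := by
  intro μ hμ h1 h2 h3 h4 h5 h6 h7 h8 h9 hU k hk hDk
  exact hcore μ hμ h1 h2 h3 h4 h5 h6 h7 h8 h9 hU k hk hDk (fun v hv => hsym μ hμ h2 k hk v hv)

end Summit.CriticalPhenomena.PercolationContinuityZ3.Cruxes.DustRigidity.BirthX2
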